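import Summits.QuantumAdvantage.AdviceFreeQNC0.TwoWindowStrategies
import Summits.QuantumAdvantage.AdviceFreeQNC0.MultiBlockElimination
import HarnessLib

/-!
# Cell qa-qnc0 (rung F-Q1, route RingFrame, crux α): bookkeeping for ring strategies supported on
# ANY number of interior windows — anchors, block weights, local character terms

Bookkeeping for the general `t`-window special case of the crux α (`RingHardU` in walk
coordinates, file `WindowLadderStrategies.lean`), over the vocabulary of
`MultiBlockElimination.lean` (`blockWts`, `allNamed`).  For block lengths `l = [L₀, …, L_t]`
(`n = Σ l`) the ANCHORS are the partial sums `P_j = (l.take j).sum` (`P_0 = 0`, `P_{t+1} = n`);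
the `i`-th block weight of `u : {0,1}ⁿ` is `R_i(u) = (blockWts l u).getD i 0`.

* `sum_take_mono`: anchors increase;
* `wtPrefix_sum_take`, `wt_eq_sum_blockWts`: `W_{P_j}(u) = Σ_{i<j} R_i(u)` and `|u| = Σ_i R_i(u)`
  (induction on `l` with `wtPrefix_append_of_ge`);
* `allNamed_iff`: unpacking the "all residues named" predicate;
* `sum_anchorCoeff_mul`, `sum_mul_lastCell`, `sum_mul_mod_three_congr`: the linear forms
  `Σ_i λ_i R_i` in the block residues that appear in the walk characters (coefficients `2` below
  the anchor index and `1` from it on; the cells `(0,…,0,w)`; dependence on residues mod `3`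
  only);
* `hasDeg_midChar`, `hasDeg_rightChar`: a character term anchored at `Pa ≤ g` is a Boolean
  function of the window `u|_{[Pa,g)}` (degree `≤ g − Pa`), a right-end term one of `u|_{[g,n)}`
  (degree `≤ n − g`).

Folklore bookkeeping (prover); no cell statement is decided here.  WHAT THIS IS NOT: anything
about α itself; the window theorem is in `WindowLadderStrategies.lean`.
-/

noncomputable section

namespace Summit.QuantumAdvantage.AdviceFreeQNC0

open Finset
open Literature.Computability.MetaComplexity Literature.Computability.MetaComplexity.Smolensky

/-! ### Anchors: partial sums of the block lengths -/

/-- Anchors increase: `(l.take j).sum ≤ (l.take k).sum` for `j ≤ k`. [folklore] -/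
theorem sum_take_mono (l : List ℕ) {j k : ℕ} (h : j ≤ k) : (l.take j).sum ≤ (l.take k).sum :=
  List.monotone_sum_take l h

/-! ### Block weights versus prefix weights -/

/-- `W_0(u) = 0`. [folklore] -/
theorem wtPrefix_zero {n : ℕ} (u : Fin n → Bool) : wtPrefix u 0 = 0 := by
  unfold wtPrefix
  rw [Finset.card_eq_zero, Finset.filter_eq_empty_iff]
  intro i _ h
  exact absurd h.1 (Nat.not_lt_zero _)

/-- **Prefix weights at the anchors are partial sums of the block weights**:
`W_{P_j}(u) = Σ_{i<j} R_i(u)` for `j ≤ |l|`, `P_j = (l.take j).sum`, `R_i(u) = (blockWts l u).getD i 0`.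
(Cell bookkeeping; induction on `l`.) -/
theorem wtPrefix_sum_take : ∀ (l : List ℕ) (j : ℕ), j ≤ l.length → ∀ u : Fin l.sum → Bool,
    wtPrefix u (l.take j).sum = ∑ i ∈ range j, (blockWts l u).getD i 0 := by
  intro l
  induction l with
  | nil =>
    intro j hj u
    have hj0 : j = 0 := by simpa using hj
    subst hj0
    simp [wtPrefix_zero]
  | cons L rest ih =>
    intro j hj u
    cases j with
    | zero => simp [wtPrefix_zero]
    | succ j =>
      have hj' : j ≤ rest.length := by simpa using hj
      change Fin (L + rest.sum) → Bool at u
      show wtPrefix u (L + (rest.take j).sum) =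
        ∑ i ∈ range (j + 1), (wt (fun i : Fin L => u (Fin.castAdd rest.sum i)) ::
          blockWts rest (fun k : Fin rest.sum => u (Fin.natAdd L k))).getD i 0
      rw [Finset.sum_range_succ', List.getD_cons_zero]
      simp only [List.getD_cons_succ]
      rw [← ih j hj' (fun k : Fin rest.sum => u (Fin.natAdd L k))]
      conv_lhs => rw [← Fin.append_castAdd_natAdd (f := u)]
      rw [wtPrefix_append_of_ge _ _ (Nat.le_add_right L _), Nat.add_sub_cancel_left, add_comm]

/-- **The total weight is the sum of the block weights**: `|u| = Σ_{i<|l|} R_i(u)`.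
(Cell bookkeeping.) -/
theorem wt_eq_sum_blockWts (l : List ℕ) (u : Fin l.sum → Bool) :
    wt u = ∑ i ∈ range l.length, (blockWts l u).getD i 0 := by
  rw [← wtPrefix_sum_take l l.length le_rfl u, List.take_length]
  exact (wtPrefix_of_length_le u le_rfl).symm

/-- Unpacking `allNamed`: every block residue is named by its decoder. (Cell bookkeeping.) -/
theorem allNamed_iff (l : List ℕ) (a b : ℕ → CubeFn (ZMod 2) l.sum)
    (dec : ℕ → ZMod 2 → ZMod 2 → ℕ) (u : Fin l.sum → Bool) :
    allNamed l a b dec u = true ↔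
      ∀ i < l.length, dec i (a i u) (b i u) % 3 = (blockWts l u).getD i 0 % 3 := by
  unfold allNamed
  simp only [List.all_eq_true, List.mem_range, decide_eq_true_eq]

/-! ### Linear forms in the block residues -/

/-- Coefficient pattern of an anchored character: `Σ_{i<T} (if i < J then 2 else 1)·R_i =
Σ_{i<T} R_i + Σ_{i<J} R_i` for `J ≤ T` (total weight plus the prefix weight at the anchor).
[folklore] -/
theorem sum_anchorCoeff_mul (T J : ℕ) (hJ : J ≤ T) (R : ℕ → ℕ) :
    ∑ i ∈ range T, (if i < J then 2 else 1) * R i = ∑ i ∈ range T, R i + ∑ i ∈ range J, R i := by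
  have h1 : ∀ i ∈ range T, (if i < J then 2 else 1) * R i = R i + if i < J then R i else 0 := by
    intro i _
    split_ifs <;> ring
  have h2 : (range T).filter (fun i => i < J) = range J := by
    ext i
    simp only [mem_filter, mem_range]
    omega
  rw [Finset.sum_congr rfl h1, Finset.sum_add_distrib, ← Finset.sum_filter, h2]

/-- In the cell `(0, …, 0, w)` only the last block carries a residue:
`Σ_{i≤T} λ_i δ_i = λ_T·w` for `δ_i = [i = T]·w`. [folklore] -/
theorem sum_mul_lastCell (T : ℕ) (lam δ : ℕ → ℕ) (w : ℕ) (hδ : ∀ i, δ i = if i = T then w else 0) :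
    ∑ i ∈ range (T + 1), lam i * δ i = lam T * w := by
  rw [Finset.sum_congr rfl (fun i _ => by rw [hδ i])]
  simp only [mul_ite, mul_zero, Finset.sum_ite_eq', Finset.mem_range, Nat.lt_succ_self, if_true]

/-- A linear form in the residues only sees the residues mod `3`. [folklore] -/
theorem sum_mul_mod_three_congr (s : Finset ℕ) (lam r r' : ℕ → ℕ)
    (h : ∀ i ∈ s, r i % 3 = r' i % 3) :
    (∑ i ∈ s, lam i * r i) % 3 = (∑ i ∈ s, lam i * r' i) % 3 := by
  rw [Finset.sum_nat_mod s 3 (fun i => lam i * r i), Finset.sum_nat_mod s 3 (fun i => lam i * r' i)]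
  refine congrArg (· % 3) (Finset.sum_congr rfl fun i hi => ?_)
  rw [Nat.mul_mod, h i hi, ← Nat.mul_mod]

/-! ### Local character terms are window functions -/

/-- **An anchored character term is a function of the window `[Pa, g)`**: for `g ≤ n` and any
constants `c, E`, `u ↦ [c + g + #{Pa ≤ i < g : u_i} + E ≢ 0 (mod 3)]` has degree `≤ g − Pa`.
(Cell bookkeeping.) -/
theorem hasDeg_midChar {n : ℕ} (c Pa g E : ℕ) (hg : g ≤ n) :
    HasDeg (fun u : Fin n → Bool => decide ((c + g +
      (univ.filter fun i : Fin n => Pa ≤ i.val ∧ i.val < g ∧ u i = true).card + E) % 3 ≠ 0))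
      (g - Pa) := by
  have h := hasDeg_comp_window (n := n) (fun j : Fin (g - Pa) => (⟨Pa + j.val, by omega⟩ : Fin n))
    (fun v : Fin (g - Pa) → Bool => decide ((c + g +
      (univ.filter fun j : Fin (g - Pa) => v j = true).card + E) % 3 ≠ 0))
  have heq : (fun u : Fin n → Bool => decide ((c + g +
      (univ.filter fun i : Fin n => Pa ≤ i.val ∧ i.val < g ∧ u i = true).card + E) % 3 ≠ 0)) =
      fun u : Fin n → Bool => (fun v : Fin (g - Pa) → Bool => decide ((c + g +
        (univ.filter fun j : Fin (g - Pa) => v j = true).card + E) % 3 ≠ 0))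
        (fun j => u ⟨Pa + j.val, by omega⟩) := by
    funext u
    simp only [midCount_eq_card_window u hg]
  rw [heq]
  exact h

/-- **A right-end character term is a function of the window `[g, n)`**: for `g ≤ n` and any
constants `c, E`, `u ↦ [c + g + 2#{i ≥ g : u_i} + E ≢ 0 (mod 3)]` has degree `≤ n − g`.
(Cell bookkeeping.) -/
theorem hasDeg_rightChar {n : ℕ} (c g E : ℕ) (hg : g ≤ n) :
    HasDeg (fun u : Fin n → Bool => decide ((c + g +
      2 * (univ.filter fun i : Fin n => g ≤ i.val ∧ u i = true).card + E) % 3 ≠ 0)) (n - g) := by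
  have h := hasDeg_comp_window (n := n) (fun j : Fin (n - g) => (⟨g + j.val, by omega⟩ : Fin n))
    (fun v : Fin (n - g) → Bool => decide ((c + g +
      2 * (univ.filter fun j : Fin (n - g) => v j = true).card + E) % 3 ≠ 0))
  have heq : (fun u : Fin n → Bool => decide ((c + g +
      2 * (univ.filter fun i : Fin n => g ≤ i.val ∧ u i = true).card + E) % 3 ≠ 0)) =
      fun u : Fin n → Bool => (fun v : Fin (n - g) → Bool => decide ((c + g +
        2 * (univ.filter fun j : Fin (n - g) => v j = true).card + E) % 3 ≠ 0))
        (fun j => u ⟨g + j.val, by omega⟩) := by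
    funext u
    simp only [wtSuffix_eq_card_window u hg]
  rw [heq]
  exact h

end Summit.QuantumAdvantage.AdviceFreeQNC0
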